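import Summits.ResolutionOfSingularities.ResolutionOfSingularities.Theorems.PurelyInseparableDim4PureLeafUnitTrap
import Summits.ResolutionOfSingularities.ResolutionOfSingularities.Theorems.PurelyInseparableDim4PureLeafGlobalWin2
import HarnessLib
import HarnessLib.Audit.Tags

/-!
# Purely inseparable fourfolds — the unit leaf `x₀x₁x₂x₃(1 + x₀)` IS an A-win of the plain game over `𝔽₂`;
# the divergent MODE-1h branch (p692194) enters the trap family (p693684) by the rule's FIRST tie-break

Census cell «res-dim4-pi» (D-0157 DOOR 2), width seat `res-dim4-p-10` (generation 3), brick (i) of desk WORD #132 (c),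
third file.  The two earlier files showed: MODE 1h (least-cardinality permissible coordinate centre, `𝔽₂`-rational
equimultiple replies) admits an INFINITE chain from the unit leaf `⟨x₀x₁x₂x₃(1 + x₀), 0, ∅⟩`
(`exists_step1h_chain_unitLeaf`), and every state of that chain from the third one on is a TRAP of the plain game
(`not_stateWins_F`, `not_stateWins_prefix`).  This file adds the positive half, a kernel-checked books-free win
certificate (19 rows, `WinCertF.stateWins_of_row`, found by the seat's AND-OR solver `plainwin.py` at depth 4; five
of the rows — `x₀x₁`, `x₀x₃`, `x₀x₂`, `x₂x₃ + x₀x₂x₃`, `x₁x₃ + x₀x₁x₃` — are already in the tree (`WinCertF.stateWins_x0x1`,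
`PureLeafGlobalWin.w13/w15/w69/w83`, generation 2) and are cited, not restated):

* `unitLeafRow18` — **for every booking `(r, exc)`, player A WINS the plain game `StateWins 2` from
  `x₀x₁x₂x₃ + x₀²x₁x₂x₃` over `𝔽₂`**, opening with the centre `{x₁, x₂}`; all 19 row states are binomials /
  quadrinomials of degree `≤ 5` and every centre used has two elements (so the winning line is itself
  MODE-1h-ADMISSIBLE at every step: least cardinality 2 is attained).
* `stateWins_unitLeaf` — the same for the literal leaf state of `exists_step1h_chain_unitLeaf`.
* `unitLeaf_win_and_trap` — the dichotomy in one statement: the leaf is won for every booking, AND there is a MODE-1h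
  chain `c` from it with `¬ StateWins 2 (c (k + 2))` for every `k` (the chain of p692194, its tail in the trap family).

Reading (TIER-2, located; plain game, `𝔽₂`-rational replies; nothing here is CJS's algorithm): at the unit leaf all six
coordinate pairs are permissible and tie for MODE 1h's «least cardinality»; the pair `{x₁, x₂}` wins in four moves,
the pair `{x₀, x₃}` (chart `x₃`, origin) leads to `x₀x₁x₂(1 + x₀x₃)` and one step later into the trap family.  So the
divergence of brick (i) is decided by the TIE-BREAK among least-cardinality centres, not forced by the polynomial —
consistent with J-007's rider (2) of record (the coordinate rule is not étale-functorial; desk WORD #141 (b)).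

All statements are def-free theorems about tree definitions (`StateWins`, `Step1h`, `evalT`, `SData.toState`); proofs
are `decide` on the tree's Boolean row checker plus the two earlier files.  [OURS · counted 0]  Nothing in this file
proves or refutes resolution of singularities in dimension ≥ 4 / characteristic p, and nothing here is stronger than
expert review. bears_on: LADDER-RESOLUTION:D157-DOOR2 (res-dim4-pi · brick (i) · positive half). Supports
stmt-ResolutionOfSingularities-16155 (helper).
-/

set_option linter.dupNamespace false

open MvPolynomial Finset

namespace Summit.ResolutionOfSingularities.ResolutionOfSingularities.Theorems.PIDim4

namespace UnitDivergence

open Literature.AlgebraicGeometry.Resolution CentreBlowup StepKit WinCertF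

/-! ## 1. The win certificate, bottom-up (children before parents; row numbers are the solver's post-order) -/

/-- Row 0: `x₀x₁ + x₀²x₁x₃` is won for every booking — centre `{x₀, x₁}`; surviving children: none (every rational reply drops the order or kills `F`). [folklore] -/
theorem unitLeafRow00 : ∀ (r : Fin 4 →₀ ℕ) (exc : Finset (Fin 4)),
    StateWins 2 (⟨evalT ([(![1, 1, 0, 0], 1), (![2, 1, 0, 1], 1)] : Terms 4 (ZMod 2)), r, exc⟩ : State (ZMod 2)) :=
  stateWins_of_row (all_nil 2) (S := {0, 1}) (by decide)

/-- Row 4: `x₀x₃ + x₀x₁x₃ + x₀²x₃ + x₀²x₁x₃` is won for every booking — centre `{x₀, x₃}`; surviving children: `x₀x₁ + x₀²x₁x₃`, `x₁x₃ + x₀x₁x₃`. [folklore] -/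
theorem unitLeafRow04 : ∀ (r : Fin 4 →₀ ℕ) (exc : Finset (Fin 4)),
    StateWins 2 (⟨evalT ([(![1, 0, 0, 1], 1), (![1, 1, 0, 1], 1), (![2, 0, 0, 1], 1), (![2, 1, 0, 1], 1)] : Terms 4 (ZMod 2)), r, exc⟩ : State (ZMod 2)) :=
  stateWins_of_row (C := [[(![1, 1, 0, 0], 1), (![2, 1, 0, 1], 1)], [(![0, 1, 0, 1], 1), (![1, 1, 0, 1], 1)]]) (all_cons unitLeafRow00 (all_cons PureLeafGlobalWin.w83 (all_nil 2))) (S := {0, 3}) (by decide)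

/-- Row 5: `x₀x₃ + x₀²x₃` is won for every booking — centre `{x₀, x₃}`; surviving children: none (every rational reply drops the order or kills `F`). [folklore] -/
theorem unitLeafRow05 : ∀ (r : Fin 4 →₀ ℕ) (exc : Finset (Fin 4)),
    StateWins 2 (⟨evalT ([(![1, 0, 0, 1], 1), (![2, 0, 0, 1], 1)] : Terms 4 (ZMod 2)), r, exc⟩ : State (ZMod 2)) :=
  stateWins_of_row (all_nil 2) (S := {0, 3}) (by decide)

/-- Row 6: `x₀x₂ + x₀²x₂` is won for every booking — centre `{x₀, x₂}`; surviving children: none (every rational reply drops the order or kills `F`). [folklore] -/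
theorem unitLeafRow06 : ∀ (r : Fin 4 →₀ ℕ) (exc : Finset (Fin 4)),
    StateWins 2 (⟨evalT ([(![1, 0, 1, 0], 1), (![2, 0, 1, 0], 1)] : Terms 4 (ZMod 2)), r, exc⟩ : State (ZMod 2)) :=
  stateWins_of_row (all_nil 2) (S := {0, 2}) (by decide)

/-- Row 7: `x₀x₂x₃ + x₀²x₂x₃` is won for every booking — centre `{x₂, x₃}`; surviving children: `x₀x₃ + x₀²x₃`, `x₀x₂ + x₀²x₂`. [folklore] -/
theorem unitLeafRow07 : ∀ (r : Fin 4 →₀ ℕ) (exc : Finset (Fin 4)),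
    StateWins 2 (⟨evalT ([(![1, 0, 1, 1], 1), (![2, 0, 1, 1], 1)] : Terms 4 (ZMod 2)), r, exc⟩ : State (ZMod 2)) :=
  stateWins_of_row (C := [[(![1, 0, 0, 1], 1), (![2, 0, 0, 1], 1)], [(![1, 0, 1, 0], 1), (![2, 0, 1, 0], 1)]]) (all_cons unitLeafRow05 (all_cons unitLeafRow06 (all_nil 2))) (S := {2, 3}) (by decide)

/-- Row 8: `x₀x₃ + x₀²x₁x₃` is won for every booking — centre `{x₀, x₃}`; surviving children: none (every rational reply drops the order or kills `F`). [folklore] -/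
theorem unitLeafRow08 : ∀ (r : Fin 4 →₀ ℕ) (exc : Finset (Fin 4)),
    StateWins 2 (⟨evalT ([(![1, 0, 0, 1], 1), (![2, 1, 0, 1], 1)] : Terms 4 (ZMod 2)), r, exc⟩ : State (ZMod 2)) :=
  stateWins_of_row (all_nil 2) (S := {0, 3}) (by decide)

/-- Row 9: `x₀x₁ + x₀x₁x₃ + x₀²x₁ + x₀²x₁x₃` is won for every booking — centre `{x₀, x₁}`; surviving children: `x₁x₃ + x₀x₁x₃`, `x₀x₃ + x₀²x₁x₃`. [folklore] -/
theorem unitLeafRow09 : ∀ (r : Fin 4 →₀ ℕ) (exc : Finset (Fin 4)),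
    StateWins 2 (⟨evalT ([(![1, 1, 0, 0], 1), (![1, 1, 0, 1], 1), (![2, 1, 0, 0], 1), (![2, 1, 0, 1], 1)] : Terms 4 (ZMod 2)), r, exc⟩ : State (ZMod 2)) :=
  stateWins_of_row (C := [[(![0, 1, 0, 1], 1), (![1, 1, 0, 1], 1)], [(![1, 0, 0, 1], 1), (![2, 1, 0, 1], 1)]]) (all_cons PureLeafGlobalWin.w83 (all_cons unitLeafRow08 (all_nil 2))) (S := {0, 1}) (by decide)

/-- Row 10: `x₀x₂ + x₀²x₂x₃` is won for every booking — centre `{x₀, x₂}`; surviving children: none (every rational reply drops the order or kills `F`). [folklore] -/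
theorem unitLeafRow10 : ∀ (r : Fin 4 →₀ ℕ) (exc : Finset (Fin 4)),
    StateWins 2 (⟨evalT ([(![1, 0, 1, 0], 1), (![2, 0, 1, 1], 1)] : Terms 4 (ZMod 2)), r, exc⟩ : State (ZMod 2)) :=
  stateWins_of_row (all_nil 2) (S := {0, 2}) (by decide)

/-- Row 13: `x₀x₃ + x₀x₂x₃ + x₀²x₃ + x₀²x₂x₃` is won for every booking — centre `{x₀, x₃}`; surviving children: `x₀x₂ + x₀²x₂x₃`, `x₂x₃ + x₀x₂x₃`. [folklore] -/
theorem unitLeafRow13 : ∀ (r : Fin 4 →₀ ℕ) (exc : Finset (Fin 4)),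
    StateWins 2 (⟨evalT ([(![1, 0, 0, 1], 1), (![1, 0, 1, 1], 1), (![2, 0, 0, 1], 1), (![2, 0, 1, 1], 1)] : Terms 4 (ZMod 2)), r, exc⟩ : State (ZMod 2)) :=
  stateWins_of_row (C := [[(![1, 0, 1, 0], 1), (![2, 0, 1, 1], 1)], [(![0, 0, 1, 1], 1), (![1, 0, 1, 1], 1)]]) (all_cons unitLeafRow10 (all_cons PureLeafGlobalWin.w69 (all_nil 2))) (S := {0, 3}) (by decide)

/-- Row 14: `x₀x₁ + x₀²x₁` is won for every booking — centre `{x₀, x₁}`; surviving children: none (every rational reply drops the order or kills `F`). [folklore] -/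
theorem unitLeafRow14 : ∀ (r : Fin 4 →₀ ℕ) (exc : Finset (Fin 4)),
    StateWins 2 (⟨evalT ([(![1, 1, 0, 0], 1), (![2, 1, 0, 0], 1)] : Terms 4 (ZMod 2)), r, exc⟩ : State (ZMod 2)) :=
  stateWins_of_row (all_nil 2) (S := {0, 1}) (by decide)

/-- Row 15: `x₀x₁x₃ + x₀²x₁x₃` is won for every booking — centre `{x₁, x₃}`; surviving children: `x₀x₃ + x₀²x₃`, `x₀x₁ + x₀²x₁`. [folklore] -/
theorem unitLeafRow15 : ∀ (r : Fin 4 →₀ ℕ) (exc : Finset (Fin 4)),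
    StateWins 2 (⟨evalT ([(![1, 1, 0, 1], 1), (![2, 1, 0, 1], 1)] : Terms 4 (ZMod 2)), r, exc⟩ : State (ZMod 2)) :=
  stateWins_of_row (C := [[(![1, 0, 0, 1], 1), (![2, 0, 0, 1], 1)], [(![1, 1, 0, 0], 1), (![2, 1, 0, 0], 1)]]) (all_cons unitLeafRow05 (all_cons unitLeafRow14 (all_nil 2))) (S := {1, 3}) (by decide)

/-- Row 16: `x₀x₃ + x₀²x₂x₃` is won for every booking — centre `{x₀, x₃}`; surviving children: none (every rational reply drops the order or kills `F`). [folklore] -/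
theorem unitLeafRow16 : ∀ (r : Fin 4 →₀ ℕ) (exc : Finset (Fin 4)),
    StateWins 2 (⟨evalT ([(![1, 0, 0, 1], 1), (![2, 0, 1, 1], 1)] : Terms 4 (ZMod 2)), r, exc⟩ : State (ZMod 2)) :=
  stateWins_of_row (all_nil 2) (S := {0, 3}) (by decide)

/-- Row 17: `x₀x₂ + x₀x₂x₃ + x₀²x₂ + x₀²x₂x₃` is won for every booking — centre `{x₀, x₂}`; surviving children: `x₂x₃ + x₀x₂x₃`, `x₀x₃ + x₀²x₂x₃`. [folklore] -/
theorem unitLeafRow17 : ∀ (r : Fin 4 →₀ ℕ) (exc : Finset (Fin 4)),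
    StateWins 2 (⟨evalT ([(![1, 0, 1, 0], 1), (![1, 0, 1, 1], 1), (![2, 0, 1, 0], 1), (![2, 0, 1, 1], 1)] : Terms 4 (ZMod 2)), r, exc⟩ : State (ZMod 2)) :=
  stateWins_of_row (C := [[(![0, 0, 1, 1], 1), (![1, 0, 1, 1], 1)], [(![1, 0, 0, 1], 1), (![2, 0, 1, 1], 1)]]) (all_cons PureLeafGlobalWin.w69 (all_cons unitLeafRow16 (all_nil 2))) (S := {0, 2}) (by decide)

/-- Row 18: `x₀x₁x₂x₃ + x₀²x₁x₂x₃` is won for every booking — centre `{x₁, x₂}`; surviving children: `x₀x₃ + x₀x₁x₃ + x₀²x₃ + x₀²x₁x₃`, `x₀x₂x₃ + x₀²x₂x₃`, `x₀x₁ + x₀x₁x₃ + x₀²x₁ + x₀²x₁x₃`, `x₀x₃ + x₀x₂x₃ + x₀²x₃ + x₀²x₂x₃`, `x₀x₁x₃ + x₀²x₁x₃`, `x₀x₂ + x₀x₂x₃ + x₀²x₂ + x₀²x₂x₃`. [folklore] -/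
theorem unitLeafRow18 : ∀ (r : Fin 4 →₀ ℕ) (exc : Finset (Fin 4)),
    StateWins 2 (⟨evalT ([(![1, 1, 1, 1], 1), (![2, 1, 1, 1], 1)] : Terms 4 (ZMod 2)), r, exc⟩ : State (ZMod 2)) :=
  stateWins_of_row (C := [[(![1, 0, 0, 1], 1), (![1, 1, 0, 1], 1), (![2, 0, 0, 1], 1), (![2, 1, 0, 1], 1)], [(![1, 0, 1, 1], 1), (![2, 0, 1, 1], 1)], [(![1, 1, 0, 0], 1), (![1, 1, 0, 1], 1), (![2, 1, 0, 0], 1), (![2, 1, 0, 1], 1)], [(![1, 0, 0, 1], 1), (![1, 0, 1, 1], 1), (![2, 0, 0, 1], 1), (![2, 0, 1, 1], 1)], [(![1, 1, 0, 1], 1), (![2, 1, 0, 1], 1)], [(![1, 0, 1, 0], 1), (![1, 0, 1, 1], 1), (![2, 0, 1, 0], 1), (![2, 0, 1, 1], 1)]]) (all_cons unitLeafRow04 (all_cons unitLeafRow07 (all_cons unitLeafRow09 (all_cons unitLeafRow13 (all_cons unitLeafRow15 (all_cons unitLeafRow17 (all_nil 2))))))) (S := {1, 2}) (by decide)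

/-! ## 2. The leaf state and the dichotomy -/

/-- **The unit leaf `⟨x₀x₁x₂x₃(1 + x₀), 0, ∅⟩` (the start of the divergent MODE-1h chain of
`exists_step1h_chain_unitLeaf`) is an A-win of the plain game over `𝔽₂`.** [folklore] -/
theorem stateWins_unitLeaf :
    StateWins 2 (⟨[(![1, 1, 1, 1], 1), (![2, 1, 1, 1], 1)], ![0, 0, 0, 0], ∅⟩ : SData 4 (ZMod 2)).toState :=
  unitLeafRow18 _ _

/-- **Dichotomy at the unit leaf.** Player A wins the plain game from `x₀x₁x₂x₃(1 + x₀)` for every booking, and yet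
MODE 1h admits an infinite chain of steps from the leaf all of whose states from the third on are LOST for A
(no strategy wins the plain game there): the chain of p692194, whose tail runs through the trap family of p693684.
[folklore] -/
theorem unitLeaf_win_and_trap :
    (∀ (r : Fin 4 →₀ ℕ) (exc : Finset (Fin 4)),
        StateWins 2 (⟨evalT ([(![1, 1, 1, 1], 1), (![2, 1, 1, 1], 1)] : Terms 4 (ZMod 2)), r, exc⟩ : State (ZMod 2))) ∧
      ∃ c : ℕ → State (ZMod 2),
        c 0 = (⟨[(![1, 1, 1, 1], 1), (![2, 1, 1, 1], 1)], ![0, 0, 0, 0], ∅⟩ : SData 4 (ZMod 2)).toState ∧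
          (∀ k, Step1h 2 (c k) (c (k + 1))) ∧ ∀ k, ¬ StateWins 2 (c (k + 2)) := by
  refine ⟨unitLeafRow18, ?_⟩
  -- the tail: iterate the family step from `⟨F 0, 0, {2}⟩`
  let tail : ℕ → State (ZMod 2) := fun k => Nat.rec
    (⟨X 1 * ((∑ t ∈ Finset.range (0 + 1), X 3 ^ (t + 1)) + X 0 + X 0 ^ 2 * X 3 ^ 0 + X 0 ^ 2 * X 3 ^ (0 + 1)), 0, {2}⟩ :
      State (ZMod 2))
    (fun _ s => step 2 ({0, 1, 3} : Finset (Fin 4)) 3 (fun i => if i = 0 then 1 else 0) s) k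
  have htail : ∀ k, ∃ exc : Finset (Fin 4), tail k =
      ⟨X 1 * ((∑ t ∈ Finset.range (k + 1), X 3 ^ (t + 1)) + X 0 + X 0 ^ 2 * X 3 ^ k + X 0 ^ 2 * X 3 ^ (k + 1)),
        0, exc⟩ := by
    intro k
    induction k with
    | zero => exact ⟨{2}, rfl⟩
    | succ k ih =>
      obtain ⟨exc, hk⟩ := ih
      refine ⟨insert 3 (exc.filter fun i => (if i = (0 : Fin 4) then (1 : ZMod 2) else 0) = 0), ?_⟩
      show step 2 ({0, 1, 3} : Finset (Fin 4)) 3 (fun i => if i = 0 then 1 else 0) (tail k) = _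
      rw [hk, step_F]
  refine ⟨fun k => if k = 0 then (⟨[(![1, 1, 1, 1], 1), (![2, 1, 1, 1], 1)], ![0, 0, 0, 0], ∅⟩ : SData 4 (ZMod 2)).toState
      else if k = 1 then (⟨[(![1, 1, 1, 0], 1), (![2, 1, 1, 1], 1)], ![0, 0, 0, 0], {3}⟩ : SData 4 (ZMod 2)).toState
      else tail (k - 2), by simp, fun k => ?_, fun k => ?_⟩
  · rcases k with _ | _ | k
    · simpa using step1h_leaf
    · simp only [zero_add, one_ne_zero, if_false, if_true, show (1 + 1 : ℕ) = 2 from rfl,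
        show ((2 : ℕ) = 0) = False from by decide, show ((2 : ℕ) = 1) = False from by decide, Nat.sub_self]
      have h := step1h_prefix
      rw [prefix_toState_eq] at h
      exact h
    · simp only [show (k + 1 + 1 = 0) = False from by simp, show (k + 1 + 1 = 1) = False from by simp,
        show (k + 1 + 1 + 1 = 0) = False from by simp, show (k + 1 + 1 + 1 = 1) = False from by simp, if_false,
        show k + 1 + 1 - 2 = k from by omega, show k + 1 + 1 + 1 - 2 = k + 1 from by omega]
      obtain ⟨exc, hk⟩ := htail k
      show Step1h 2 (tail k) (tail (k + 1))
      have hsucc : tail (k + 1) = step 2 ({0, 1, 3} : Finset (Fin 4)) 3 (fun i => if i = 0 then 1 else 0) (tail k) := rfl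
      rw [hsucc, hk, step_F]
      exact step1h_F k exc
  · simp only [show (k + 2 = 0) = False from by simp, show (k + 2 = 1) = False from by simp, if_false,
      show k + 2 - 2 = k from by omega]
    obtain ⟨exc, hk⟩ := htail k
    show ¬ StateWins 2 (tail k)
    rw [hk]
    exact not_stateWins_F k 0 exc

end UnitDivergence

end Summit.ResolutionOfSingularities.ResolutionOfSingularities.Theorems.PIDim4
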